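import Summits.ValiantsHypothesis.ValiantsHypothesis.Theorems.DefinabilityGapK2cVPSPACE0Rung
import Literature.Computability.AlgebraicComplexity.VNPClosedUnderIteratedDerivatives
import Literature.Computability.AlgebraicComplexity.ValiantConjectureEquivProofs
import Literature.Computability.AlgebraicComplexity.BurgisserBooleanParts
import Literature.Barriers.ValiantsHypothesis.CT23SuccinctHittingSetsVersusVPSPACE

/-!
# DefinabilityGap — what the collapse-lift residual of K2c IS: the separation transfer
# `VP_ℂ ≠ VPSPACE⁰_b ⟹ VP_ℂ ≠ VNP_ℂ`

Route `DefinabilityGap`, crux K2c `KIAnnihilatorDefinableOnCollapse` (`stmt-ValiantsHypothesis-23546`). After rung 4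
(`DefinabilityGapK2cVPSPACE0Rung.k2c_vpspace0b_rung`: the planted map has `VPSPACE⁰_b` annihilators, unconditionally)
the only open content of K2c is the collapse-lift "`VP = VNP ⟹ VPSPACE⁰_b ⊆ VNP_ℂ`" (kit SPLIT-KIT-v2 §3B option B″,
decl `CollapseLiftsVPSPACE0b`). THIS FILE identifies that statement, by a kernel-checked `Iff`, with the SEPARATION
TRANSFER "if some integer `VPSPACE⁰_b` family is not in `VP_ℂ` then `VP_ℂ ≠ VNP_ℂ`" — i.e. "Chatterjee–Tengse's target
separation `VP ≠ VPSPACE_b` implies Valiant's hypothesis" (`collapseLift_iff_separationTransfer`); and records that the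
transfer's witness is supplied by EITHER explicit-hitting hypothesis in the tree: crux K1 of this route (the planted
Kabanets–Impagliazzo generator; `separationWitness_of_kiPlantedHitting`, via rung 4's corollary) or route BarrierLever's
`SuccinctHittingSetsForVP ℂ` (CT23 Thm. 1.4, the tree's `exists_isVPSPACE0bFamily_not_isVPFamily_of_succinctHittingSetsForVP`;
`separationWitness_of_succinctHittingSets`) — either one plus the transfer gives `VP ≠ VNP` by modus ponens. Both statements of the `Iff` are spelled out (no route decls), so the file
stands before and after any split. Honest framing: the transfer is OPEN (a `PSPACE`-vs-`PH`-flavoured gap: Koiran–Perifel 2009,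
Poizat 2008; `VP = VNP` is only known to collapse `PH/poly`, Bürgisser 2000 Cor. 4.6); nothing here proves `VP ≠ VNP`.

## References

* [ChatterjeeTengse2023] P. Chatterjee, A. Tengse, *Lower Bounds from Succinct Hitting Sets*, arXiv:2309.07612v2, Def. 2.20,
  §2.2, Thm. 1.4.
* [Burgisser2000] P. Bürgisser, *Completeness and Reduction in Algebraic Complexity Theory*, Springer 2000, Def. 2.5,
  Rem. 2.2, §2.1, Cor. 4.6.
* [KoiranPerifel2009VPSPACE] P. Koiran, S. Perifel, *VPSPACE and a transfer theorem over the reals*, comput. complexity 18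
  (2009).
-/

noncomputable section

open MvPolynomial
open Literature.Computability.AlgebraicComplexity
open Literature.Barriers.ValiantsHypothesis
open Summit.ValiantsHypothesis.ValiantsHypothesis.Theses.DefinabilityGap (KIPlantedHitting)

namespace Summit.ValiantsHypothesis.ValiantsHypothesis.Theorems.DefinabilityGapCollapseLiftIff

/-- **The collapse-lift IS the separation transfer.** `(VP_ℂ = VNP_ℂ ⟹ every integer VPSPACE⁰_b family, read over ℂ,
is in VNP_ℂ)` holds iff `(some integer VPSPACE⁰_b family read over ℂ is not in VP_ℂ) ⟹ VP_ℂ ≠ VNP_ℂ`.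
(`⟹`: under the collapse a `VNP` family is `VP`, in any finite index types — Bürgisser Rem. 2.2, the tree's
`IsVNPFamily.isVPFamily_of_forall_fin`; `⟸`: `VP ⊆ VNP`.) [cite: Burgisser2000, Def. 2.5, Rem. 2.2 and §2.1; ChatterjeeTengse2023, Def. 2.20] -/
theorem collapseLift_iff_separationTransfer :
    (VP ℂ = VNP ℂ → ∀ (σ : ℕ → Type) [∀ n, Fintype (σ n)] [∀ n, DecidableEq (σ n)]
        (P : ∀ n, MvPolynomial (σ n) ℤ), IsVPSPACE0bFamily P →
        IsVNPFamily (fun n => map (Int.castRingHom ℂ) (P n))) ↔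
    ((∃ (σ : ℕ → Type) (_ : ∀ n, Fintype (σ n)) (_ : ∀ n, DecidableEq (σ n))
        (P : ∀ n, MvPolynomial (σ n) ℤ), IsVPSPACE0bFamily P ∧
          ¬ IsVPFamily (fun n => map (Int.castRingHom ℂ) (P n))) → VP ℂ ≠ VNP ℂ) := by
  constructor
  · rintro hlift ⟨σ, _, _, P, hP, hnot⟩ hEq
    have hfin : ∀ (v : ℕ → ℕ) (g : ∀ n, MvPolynomial (Fin (v n)) ℂ), IsVNPFamily g → IsVPFamily g :=
      fun v g hg => show (⟨v, g⟩ : PolyFamily ℂ) ∈ VP ℂ by rw [hEq]; exact hg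
    exact hnot (IsVNPFamily.isVPFamily_of_forall_fin hfin (hlift hEq σ P hP))
  · intro hsep hEq σ _ _ P hP
    by_contra hnot
    exact hsep ⟨σ, inferInstance, inferInstance, P, hP, fun hVP => hnot (IsVPFamily.isVNPFamily_holds' hVP)⟩ hEq

/-- **K1 supplies the transfer's witness.** The planted-generator crux K1 gives an integer `VPSPACE⁰_b` family, read
over `ℂ`, outside `VP_ℂ` (rung 4's corollary, packaged in the transfer's hypothesis shape); so K1 and the separation
transfer give `VP_ℂ ≠ VNP_ℂ` by modus ponens — the route after the B″ split, read directly.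
[cite: ChatterjeeTengse2023, Thm. 1.4; KabanetsImpagliazzo2003, Thm. 7.7] -/
theorem separationWitness_of_kiPlantedHitting (hK1 : KIPlantedHitting) :
    ∃ (σ : ℕ → Type) (_ : ∀ n, Fintype (σ n)) (_ : ∀ n, DecidableEq (σ n))
      (P : ∀ n, MvPolynomial (σ n) ℤ), IsVPSPACE0bFamily P ∧
        ¬ IsVPFamily (fun n => map (Int.castRingHom ℂ) (P n)) := by
  obtain ⟨A, hA, hnot⟩ :=
    DefinabilityGapK2cVPSPACE0Rung.exists_isVPSPACE0bFamily_not_isVPFamily_of_kiPlantedHitting hK1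
  exact ⟨fun m => Fin 3 → Fin (DefinabilityGapAffineRung.qOf m), inferInstance, inferInstance, A, hA, hnot⟩

/-- **BarrierLever's crux supplies the same witness**: `VP`-succinct hitting sets for `VP_ℂ` (FSV18 Question 6 / CT23
Thm. 1.4, the tree's `exists_isVPSPACE0bFamily_not_isVPFamily_of_succinctHittingSetsForVP`) give an integer `VPSPACE⁰_b`
family outside `VP_ℂ`, in the transfer's hypothesis shape. So the collapse-lift residual of K2c is a residual SHARED with
route BarrierLever's hitting-set half: either hypothesis plus the transfer gives `VP_ℂ ≠ VNP_ℂ`.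
[cite: ChatterjeeTengse2023, Thm. 1.4; ForbesShpilkaVolk2018, Question 6] -/
theorem separationWitness_of_succinctHittingSets (h : SuccinctHittingSetsForVP ℂ) :
    ∃ (σ : ℕ → Type) (_ : ∀ n, Fintype (σ n)) (_ : ∀ n, DecidableEq (σ n))
      (P : ∀ n, MvPolynomial (σ n) ℤ), IsVPSPACE0bFamily P ∧
        ¬ IsVPFamily (fun n => map (Int.castRingHom ℂ) (P n)) := by
  classical
  obtain ⟨P, hP, hnot⟩ := exists_isVPSPACE0bFamily_not_isVPFamily_of_succinctHittingSetsForVP ℂ h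
  exact ⟨_, inferInstance, inferInstance, P, hP, hnot⟩

end Summit.ValiantsHypothesis.ValiantsHypothesis.Theorems.DefinabilityGapCollapseLiftIff

end
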